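import Literature.Barriers.CriticalPhenomena.LaceExpansionGaussianDeconvolution
import Literature.Barriers.CriticalPhenomena.LaceExpansionIsingDeconvolutionProp12FourierRep
import Literature.Barriers.CriticalPhenomena.LaceExpansionKernelFourier
import Literature.Analysis.FunctionSpaces.TorusFourierCalculus
import Literature.Analysis.FunctionSpaces.TorusAxisAverage
import Literature.Analysis.Fourier.TorusRiemannLebesgue
import HarnessLib

/-!
# Liu–Slade 2024: Lemma 2.9 (`LiuSlade2024_lem29_holds`) and `C_1 = ∫ e^{-ik·x}/(1 - D̂_nn)`
# (`srwGreen_eq_fourierInverseG_holds`)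

Barrier catalogue `Literature/Barriers/CriticalPhenomena/` (D-0021), companion of
`LaceExpansionGaussianDeconvolution.lean`, which decomposes Liu–Slade 2024, Theorem 1.2
(`LiuSlade2024_thm12_critical`, an input of Liu–Slade 2026, Thm. 1.7 and hence of Sakai's
Theorem 1.3 for the spread-out Ising model, `LaceExpansionIsingAboveFour`) into four named inputs.
This file DISCHARGES two of them:

* `srwGreen_eq_fourierInverseG_holds` — "`C_1(x)` is the expected number of visits to `x`": for
  `d > 2` the series `Σ_n D_nn^{*n}(x)` (`srwGreen`) equals the Fourier integral (1.5)/(1.8)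
  `∫_{𝕋^d} e^{-ik·x}/(1 - D̂_nn(k)) dk/(2π)^d` (`fourierInverseG (lsA d 1)`). Proof: the torus-side
  integral is Hara's cube-side `H(x)` with `g = δ₀`, `J = D_nn` (`fourierInverseG_eq_re_haraH`),
  whose integrand has real part `cos(k·x) · (ε(k)/d)⁻¹` (`1 - D̂_nn = ε/d`, (5.8) of Liu–Slade 2026),
  and `Σ_n D_nn^{*n}(x) = (2π)^{-d}∫ cos(k·x)(ε(k)/d)⁻¹ dk` is the tree's `srwGreen_eq_integral`.
* `LiuSlade2024_lem29_holds` — Lemma 2.9 (decay of Fourier coefficients from `⌊a⌋` weak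
  derivatives and a Hölder estimate `‖U_u ĥ_α‖₁ ≤ K u^η` on the top-order ones):
  `|h(x)| ≤ c_{d,a,η} ⟦x⟧^{-a}(‖ĥ‖₁ + K + M)`. Proof (the source's, §2.3.1, in the coordinate
  `t = k/2π`): testing the weak-derivative identity (Definition A.1) against the real and imaginary
  parts of the character `e_{-x}` gives `(2πi x_j)^n 𝓕ĥ(x) = 𝓕ĥ_α(x)` for `α = (j,…,j)`,
  `n = ⌊a⌋` (Lemma 2.8 / integration by parts); translation invariance of Haar measure gives
  `𝓕(U_u g)(x) = 2i sin(2π x_j u) 𝓕g(x)`; choosing `u = 1/(4|x_j|)` with `|x_j| = ‖x‖_∞ ≥ |x|/√d`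
  yields `|x|^{n+η}|h(x)| ≤ d^{(n+1)/2} K`, and `n + η > a`.

Part 3 adds, as a THEOREM, the integer-order companion **Liu–Slade 2024, Lemma 2.3 = Liu–Slade
2026, Lemma 3.1** (`LiuSlade2024_lem23`): if `ĥ` is `n` times weakly differentiable then
`|h(x)| ≤ c_{d,n} ⟦x⟧^{-n} max(‖ĥ‖₁, max_{|α|=n} ‖ĥ_α‖₁)` and `|x|ⁿ h(x) → 0` — the decay lemma
through which the proof of Liu–Slade 2026, Theorem 2.2 (`LiuSlade2026_thm22`) passes from its
Proposition 3.2 to (2.8); the `o(1)` clause is the Riemann–Lebesgue lemma on `𝕋^d`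
(`Literature.Analysis.Fourier.tendsto_mFourierCoeff_cofinite`) applied to the `ĥ_α`.

No new definitions, no new named facts (D-0026: net debt −2).

## References

* Y. Liu, G. Slade, *Gaussian deconvolution and the lace expansion*, Probab. Theory Related
  Fields 195 (2024), arXiv:2310.07635: §1.2 ((1.3)–(1.5), (1.8)), §2.2.1 (Lemma 2.3 and its
  proof: "[Graf14, Prop. 3.3.1]", Riemann–Lebesgue), §2.3.1 (definition of `U_u`, Lemmas 2.8–2.9
  and the proof of Lemma 2.9), Appendix A (Definition A.1) [LiuSlade2024].
* Y. Liu, G. Slade, *Gaussian deconvolution and the lace expansion for spread-out models*,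
  Ann. Inst. H. Poincaré Probab. Statist. 62 (2026), arXiv:2310.07640: (1.7)–(1.8), (2.1), (5.8),
  Lemma 3.1 with (3.7) ("which repeats [LS24a, Lemma 2.3]") [LiuSlade2026].
* L. Grafakos, *Classical Fourier Analysis* (3rd ed., 2014), Prop. 3.1.2 (5) (translation),
  Prop. 3.2.6 (8) (`𝓕(∂ⱼg)(k) = 2πi kⱼ 𝓕g(k)`) [Grafakos2014].
-/

noncomputable section

namespace Literature.Barriers.CriticalPhenomena.SpreadOutIsing

open Filter Finset UnitAddTorus Literature.Probability.LatticeModels Real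
open Literature.Analysis.FunctionSpaces Literature.Analysis.FunctionSpaces.Torus
open _root_.MeasureTheory _root_.Topology

variable {d : ℕ}

/-! ## Part 1. `C_1(x) = ∫ e^{-ik·x}/(1 - D̂_nn(k)) dk/(2π)^d` -/

/-- `Σ_x |D_nn(x)| < ∞` (finite support). [folklore] -/
theorem summable_abs_srwStep : Summable fun x : Site d => |srwStep d x| :=
  summable_of_ne_finset_zero (s := (zdGraph d).neighborFinset 0) fun y hy => by
    rw [srwStep_of_not_mem hy, abs_zero]

/-- `Ĵ = D̂_nn` is real with `1 - Re D̂_nn(k) = ε(k)/d` (`d ≥ 1`; Liu–Slade 2026, (5.8):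
`D̂_nn = 1 - ε/d`). [cite: LiuSlade2026, (5.8)] -/
theorem one_sub_re_latticeFT_srwStep (hd : 1 ≤ d) (k : Fin d → ℝ) :
    1 - (latticeFT (srwStep d) k).re = dispersion k / d := by
  rw [latticeFT_eq_re_of_even summable_abs_srwStep srwStep_neg k, Complex.ofReal_re,
    tsum_eq_sum (s := (zdGraph d).neighborFinset 0)
      (fun y hy => by rw [srwStep_of_not_mem hy, zero_mul])]
  have h := stepSymbol_srwStep hd k
  unfold stepSymbol at h
  rw [h]
  ring

/-- The integrand of Hara's `H(x)` for `J = D_nn`, `g = δ₀` is `e^{ik·x} (ε(k)/d)⁻¹` (`d ≥ 1`).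
[cite: LiuSlade2026, (2.1) and (5.8)] -/
theorem haraIntegrand_srwStep_delta0 (hd : 1 ≤ d) (x : Site d) (k : Fin d → ℝ) :
    haraIntegrand (srwStep d) delta0 x k =
      Complex.exp (Complex.I * (kdot k x : ℂ)) * (((dispersion k / d)⁻¹ : ℝ) : ℂ) := by
  unfold haraIntegrand
  rw [latticeFT_delta0, one_sub_latticeFT_eq_ofReal summable_abs_srwStep srwStep_neg k,
    one_sub_re_latticeFT_srwStep hd, one_div, Complex.ofReal_inv]

/-- **Discharge of `srwGreen_eq_fourierInverseG`** ("`C_1(x)` is the expected number of visits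
to `x`", Liu–Slade 2024, (1.3)–(1.5)): for `d > 2` and every `x ∈ ℤ^d`,
`Σ_n D_nn^{*n}(x) = ∫_{𝕋^d} e^{-ik·x}/(1 - D̂_nn(k)) dk/(2π)^d`.
[cite: LiuSlade2024, §1.2, (1.3)–(1.5) and the sentence following (1.6)] -/
theorem srwGreen_eq_fourierInverseG_holds : srwGreen_eq_fourierInverseG := by
  intro d hd x
  have hd1 : 1 ≤ d := by omega
  have hd3 : 3 ≤ d := by omega
  have hd0 : (0 : ℝ) < d := by exact_mod_cast (show 0 < d by omega)
  -- torus side → Hara's cube side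
  have hsum : Summable fun y : Site d => |lsA d 1 y| := by
    simp_rw [lsA_one]
    exact (summable_abs_delta0.of_abs.sub summable_abs_srwStep.of_abs).abs
  rw [fourierInverseG_eq_re_haraH hsum x]
  have hJ : (fun y : Site d => delta0 y - lsA d 1 y) = srwStep d := by
    funext y; rw [lsA_one]; ring
  rw [hJ, haraH]
  -- the integrand and its integrability
  have hint : IntegrableOn (fun k => haraIntegrand (srwStep d) delta0 x k) (cube d) := by
    simp_rw [haraIntegrand_srwStep_delta0 hd1 x]
    have hG : IntegrableOn (fun k : Fin d → ℝ => (((dispersion k / d)⁻¹ : ℝ) : ℂ)) (cube d) volume := by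
      have hR : IntegrableOn (fun k : Fin d → ℝ => (d : ℝ) * (1 / dispersion k)) (cube d) volume :=
        ((integrable_indicator_iff (measurableSet_brillouin d)).1
          (integrable_indicator_inv_dispersion (d := d) hd3)).const_mul _
      have hR' : IntegrableOn (fun k : Fin d → ℝ => (dispersion k / d)⁻¹) (cube d) volume := by
        refine hR.congr_fun (fun k _ => ?_) (measurableSet_brillouin d)
        show (d : ℝ) * (1 / dispersion k) = (dispersion k / d)⁻¹
        rw [inv_div, mul_one_div]
      exact hR'.ofReal
    refine Integrable.bdd_mul (c := 1) hG ?_ (ae_of_all _ fun k => ?_)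
    · exact (Complex.continuous_exp.comp (continuous_const.mul
        (Complex.continuous_ofReal.comp (continuous_kdot_left x)))).aestronglyMeasurable
    · rw [Complex.norm_exp]
      simp
  -- real parts
  have h2π : ((2 * Real.pi : ℂ)) ^ d = (((2 * Real.pi) ^ d : ℝ) : ℂ) := by push_cast; ring
  rw [h2π, Complex.div_ofReal_re]
  have hre : (∫ k in cube d, haraIntegrand (srwStep d) delta0 x k).re =
      ∫ k in cube d, (dispersion k / d)⁻¹ * Real.cos (kdot k x) := by
    rw [← RCLike.re_to_complex, ← integral_re hint]
    refine integral_congr_ae (ae_of_all _ fun k => ?_)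
    simp only [RCLike.re_to_complex]
    rw [haraIntegrand_srwStep_delta0 hd1, Complex.re_mul_ofReal, mul_comm Complex.I,
      Complex.exp_ofReal_mul_I_re, mul_comm]
  rw [hre, srwGreen_eq_integral hd3 x, div_eq_inv_mul]

/-! ## Part 2. Liu–Slade 2024, Lemma 2.9

Throughout, `𝕋^d = UnitAddTorus (Fin d)` with its global `volume` (the Haar probability measure,
the source's `dk/(2π)^d` in the coordinate `k = 2πt`), `𝓕g(x) = mFourierCoeff g x = ∫ e_{-x} g`. -/

section Characters

/-- `|e_n(t)| = 1`. [folklore] -/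
theorem norm_mFourier_apply {ι : Type*} [Fintype ι] (n : ι → ℤ) (t : UnitAddTorus ι) :
    ‖mFourier n t‖ = 1 := by
  simp only [mFourier, fourier_apply, ContinuousMap.coe_mk, norm_prod, Circle.norm_coe,
    Finset.prod_const_one]

/-- `|𝓕g(x)| ≤ ‖g‖₁`. [folklore] -/
theorem norm_mFourierCoeff_le (g : UnitAddTorus (Fin d) → ℂ) (x : Site d) :
    ‖mFourierCoeff g x‖ ≤ ∫ t, ‖g t‖ := by
  rw [mFourierCoeff_eq_integral_volume]
  refine (norm_integral_le_integral_norm _).trans (le_of_eq ?_)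
  refine integral_congr_ae (ae_of_all _ fun t => ?_)
  simp only [smul_eq_mul, norm_mul, norm_mFourier_apply, one_mul]

/-- A bounded continuous complex weight times an integrable function is integrable (used for
characters and their real and imaginary parts against `L¹` functions). [folklore] -/
theorem integrable_continuous_mul {ψ g : UnitAddTorus (Fin d) → ℂ} (hψ : Continuous ψ)
    (hg : Integrable g) : Integrable fun t => ψ t * g t := by
  obtain ⟨C, hC⟩ := isCompact_univ.exists_bound_of_continuousOn hψ.continuousOn
  exact Integrable.bdd_mul (c := C) hg hψ.aestronglyMeasurable
    (ae_of_all _ fun t => hC t (Set.mem_univ t))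

/-- `∫ (Re ψ) g + i ∫ (Im ψ) g = ∫ ψ g` for continuous `ψ` and integrable `g`: the passage from the
real test functions of Definition A.1 to the complex character `e_{-x}`. [folklore] -/
theorem integral_re_smul_add_I_mul {ψ g : UnitAddTorus (Fin d) → ℂ} (hψ : Continuous ψ)
    (hg : Integrable g) :
    (∫ t, (ψ t).re • g t) + Complex.I * ∫ t, (ψ t).im • g t = ∫ t, ψ t * g t := by
  have h1 : Integrable fun t => ((ψ t).re : ℂ) * g t :=
    integrable_continuous_mul (Complex.continuous_ofReal.comp (Complex.continuous_re.comp hψ)) hg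
  have h2 : Integrable fun t => ((ψ t).im : ℂ) * g t :=
    integrable_continuous_mul (Complex.continuous_ofReal.comp (Complex.continuous_im.comp hψ)) hg
  simp_rw [Complex.real_smul]
  rw [← integral_const_mul, ← integral_add h1 (h2.const_mul _)]
  refine integral_congr_ae (ae_of_all _ fun t => ?_)
  show ((ψ t).re : ℂ) * g t + Complex.I * (((ψ t).im : ℂ) * g t) = ψ t * g t
  have : ((ψ t).re : ℂ) * g t + Complex.I * (((ψ t).im : ℂ) * g t) =
      (((ψ t).re : ℂ) + (ψ t).im * Complex.I) * g t := by ring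
  rw [this, Complex.re_add_im]

/-- Iterated partial derivatives, in one direction `j`, of the real (or imaginary, or any
`ℝ`-linear) part of a smooth eigenfunction `g` of `∂ⱼ` (`∂ⱼ g = μ g`): `∇^{(j,…,j)} (L ∘ g) =
L ∘ (μⁿ g)`. [folklore] -/
theorem iterPartialDeriv_replicate_clm {g : UnitAddTorus (Fin d) → ℂ} (hg : Torus.IsSmooth g)
    {j : Fin d} {μ : ℂ} (hμ : ∀ t, Torus.partialDeriv j g t = μ * g t) (L : ℂ →L[ℝ] ℝ) :
    ∀ n : ℕ, iterPartialDeriv (List.replicate n j) (fun t => L (g t)) = fun t => L (μ ^ n * g t)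
  | 0 => by simp
  | n + 1 => by
    rw [List.replicate_succ, iterPartialDeriv_cons, iterPartialDeriv_replicate_clm hg hμ L n]
    funext t
    have hs : Torus.IsSmooth (fun s => μ ^ n * g s) := contDiff_const.mul hg
    have h1 : Torus.partialDeriv j (fun s => L (μ ^ n * g s)) t =
        L (Torus.partialDeriv j (fun s => μ ^ n * g s) t) :=
      partialDeriv_clm_comp hs L j t
    have h2 : Torus.partialDeriv j (fun s => μ ^ n * g s) t = μ ^ n * Torus.partialDeriv j g t :=
      ((hg.hasDerivAt_line_zero j t).const_mul (μ ^ n)).deriv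
    rw [h1, h2, hμ t, pow_succ]
    ring_nf

/-- The characters are eigenfunctions of `∂ⱼ`: `∂ⱼ e_{-x} = -(2πi xⱼ) e_{-x}`. [cite: Grafakos2014, Prop. 3.2.6 (8)] -/
theorem partialDeriv_mFourier_neg (x : Site d) (j : Fin d) (t : UnitAddTorus (Fin d)) :
    Torus.partialDeriv j (⇑(mFourier (-x)) : UnitAddTorus (Fin d) → ℂ) t =
      -(2 * π * Complex.I * (x j : ℂ)) * mFourier (-x) t := by
  rw [partialDeriv_mFourier]
  simp only [Pi.neg_apply, Int.cast_neg]
  ring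

/-- **`𝓕(ĥ_α)(x) = (2πi xⱼ)ⁿ 𝓕ĥ(x)` for the weak derivative of order `α = (j,…,j)`, `|α| = n`**
(Definition A.1 tested against the real and imaginary parts of the smooth character `e_{-x}`;
the source's integration by parts in the proof of Lemma 2.9, in the coordinate `t = k/2π`).
[cite: LiuSlade2024, Appendix A, Definition A.1, and §2.3.1 (proof of Lemma 2.9)] -/
theorem mFourierCoeff_weakDeriv_replicate {hh w : UnitAddTorus (Fin d) → ℂ} {j : Fin d} {n : ℕ}
    (hw : HasTorusWeakDeriv hh (List.replicate n j) w) (x : Site d) :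
    mFourierCoeff w x = (2 * π * Complex.I * (x j : ℂ)) ^ n * mFourierCoeff hh x := by
  obtain ⟨hint, hwint, hweak⟩ := hw
  set e : UnitAddTorus (Fin d) → ℂ := ⇑(mFourier (-x)) with he
  set μ : ℂ := -(2 * π * Complex.I * (x j : ℂ)) with hμ
  have hes : Torus.IsSmooth e := isSmooth_mFourier (-x)
  have hec : Continuous e := (mFourier (-x)).continuous
  have heμ : ∀ t, Torus.partialDeriv j e t = μ * e t := partialDeriv_mFourier_neg x j
  -- the two real test functions `Re (μⁿ e)`-chains
  have hre := hweak (fun t => Complex.reCLM (e t)) (hes.comp_clm Complex.reCLM)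
  have him := hweak (fun t => Complex.imCLM (e t)) (hes.comp_clm Complex.imCLM)
  rw [iterPartialDeriv_replicate_clm hes heμ Complex.reCLM n, List.length_replicate] at hre
  rw [iterPartialDeriv_replicate_clm hes heμ Complex.imCLM n, List.length_replicate] at him
  simp only [Complex.reCLM_apply, Complex.imCLM_apply] at hre him
  -- combine real and imaginary parts
  have hψc : Continuous fun t => μ ^ n * e t := continuous_const.mul hec
  have hL : μ ^ n * mFourierCoeff hh x = ∫ t, (μ ^ n * e t) * hh t := by
    rw [mFourierCoeff_eq_integral_volume, ← integral_const_mul]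
    refine integral_congr_ae (ae_of_all _ fun t => ?_)
    simp only [smul_eq_mul, he]
    ring
  have hR : mFourierCoeff w x = ∫ t, e t * w t := by
    rw [mFourierCoeff_eq_integral_volume]
    rfl
  have h1 := integral_re_smul_add_I_mul hψc hint
  have h2 := integral_re_smul_add_I_mul hec hwint
  rw [hre, him] at h1
  -- `μⁿ 𝓕hh = (-1)ⁿ 𝓕w`
  have hkey : μ ^ n * mFourierCoeff hh x = (-1 : ℂ) ^ n * mFourierCoeff w x := by
    rw [hL, ← h1, hR, ← h2]
    ring
  -- solve for `𝓕w`
  have hsq : ((-1 : ℂ) ^ n) * ((-1 : ℂ) ^ n) = 1 := by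
    rw [← mul_pow, neg_one_mul, neg_neg, one_pow]
  calc mFourierCoeff w x = ((-1 : ℂ) ^ n * (-1 : ℂ) ^ n) * mFourierCoeff w x := by rw [hsq, one_mul]
    _ = (-1 : ℂ) ^ n * (μ ^ n * mFourierCoeff hh x) := by rw [hkey]; ring
    _ = ((-1) * μ) ^ n * mFourierCoeff hh x := by rw [mul_pow]; ring
    _ = (2 * π * Complex.I * (x j : ℂ)) ^ n * mFourierCoeff hh x := by
        rw [hμ, neg_one_mul, neg_neg]

/-- **`𝓕(U_u g)(x) = (e^{2πi xⱼu} - e^{-2πi xⱼu}) 𝓕g(x)`** (translation invariance of Haar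
measure; Grafakos 2014, Prop. 3.1.2 (5)). [cite: LiuSlade2024, §2.3.1 (definition of U_u)] -/
theorem mFourierCoeff_torusDiff {g : UnitAddTorus (Fin d) → ℂ} (hg : Integrable g) (j : Fin d)
    (u : ℝ) (x : Site d) :
    mFourierCoeff (torusDiff j u g) x =
      ((fourier (x j) ((u : ℝ) : UnitAddCircle) : ℂ) -
        fourier (x j) (((-u : ℝ)) : UnitAddCircle)) * mFourierCoeff g x := by
  have hsub : torusDiff j u g = fun t =>
      g (t + Pi.single j ((u : ℝ) : UnitAddCircle)) - g (t + Pi.single j (((-u : ℝ)) : UnitAddCircle)) := by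
    funext t
    rw [torusDiff, sub_eq_add_neg t (Pi.single j _), ← Pi.single_neg, ← AddCircle.coe_neg]
  have hi : ∀ s : UnitAddCircle, Integrable fun t => mFourier (-x) t • g (t + Pi.single j s) := by
    intro s
    simp_rw [smul_eq_mul]
    exact integrable_continuous_mul (mFourier (-x)).continuous (hg.comp_add_right _)
  rw [hsub, mFourierCoeff_eq_integral_volume]
  simp_rw [smul_sub]
  rw [integral_sub (hi _) (hi _), ← mFourierCoeff_eq_integral_volume, ← mFourierCoeff_eq_integral_volume,
    mFourierCoeff_comp_add_single, mFourierCoeff_comp_add_single, smul_eq_mul, smul_eq_mul, sub_mul]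

/-- `|e^{2πi n u} - e^{-2πi n u}| = 2|sin(2π n u)|`. [folklore] -/
theorem norm_fourier_sub_fourier_neg (n : ℤ) (u : ℝ) :
    ‖(fourier n ((u : ℝ) : UnitAddCircle) : ℂ) - fourier n (((-u : ℝ)) : UnitAddCircle)‖ =
      2 * |Real.sin (2 * π * n * u)| := by
  rw [fourier_coe_apply, fourier_coe_apply]
  have h1 : (2 * π * Complex.I * n * (u : ℝ) / (1 : ℝ) : ℂ) = ((2 * π * n * u : ℝ) : ℂ) * Complex.I := by
    push_cast; ring
  have h2 : (2 * π * Complex.I * n * ((-u : ℝ) : ℝ) / (1 : ℝ) : ℂ) =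
      -((2 * π * n * u : ℝ) : ℂ) * Complex.I := by
    push_cast; ring
  rw [h1, h2, Complex.exp_mul_I, Complex.exp_mul_I, Complex.cos_neg, Complex.sin_neg,
    ← Complex.ofReal_cos, ← Complex.ofReal_sin]
  have : ((Real.cos (2 * π * n * u) : ℂ) + (Real.sin (2 * π * n * u) : ℂ) * Complex.I -
      ((Real.cos (2 * π * n * u) : ℂ) + -(Real.sin (2 * π * n * u) : ℂ) * Complex.I)) =
      (2 * Real.sin (2 * π * n * u) : ℝ) * Complex.I := by
    push_cast; ring
  rw [this, norm_mul, Complex.norm_I, mul_one, Complex.norm_real, Real.norm_eq_abs, abs_mul,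
    abs_of_pos two_pos]

end Characters

/-! ### Elementary inequalities on `ℤ^d` -/

/-- `|x| ≤ √d ‖x‖_∞`: if `|xᵢ| ≤ m` for all `i` then `|x| ≤ √d m`. [folklore] -/
theorem euclidNorm_le_sqrt_mul {x : Site d} {m : ℝ} (hm : 0 ≤ m) (h : ∀ i, |(x i : ℝ)| ≤ m) :
    euclidNorm x ≤ Real.sqrt d * m := by
  unfold euclidNorm
  calc Real.sqrt (∑ i, ((x i : ℤ) : ℝ) ^ 2) ≤ Real.sqrt (∑ _i : Fin d, m ^ 2) := by
        refine Real.sqrt_le_sqrt (Finset.sum_le_sum fun i _ => ?_)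
        rw [← sq_abs]
        exact pow_le_pow_left₀ (abs_nonneg _) (h i) 2
    _ = Real.sqrt d * m := by
        rw [Finset.sum_const, Finset.card_univ, Fintype.card_fin, nsmul_eq_mul,
          Real.sqrt_mul (Nat.cast_nonneg d), Real.sqrt_sq hm]

/-- `|xⱼ| ≤ |x|`. [folklore] -/
theorem abs_apply_le_euclidNorm (x : Site d) (j : Fin d) : |(x j : ℝ)| ≤ euclidNorm x := by
  unfold euclidNorm
  rw [← Real.sqrt_sq_eq_abs]
  exact Real.sqrt_le_sqrt (Finset.single_le_sum (fun i _ => sq_nonneg ((x i : ℤ) : ℝ)) (Finset.mem_univ j))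

/-! ### The lemma -/

/-- **Discharge of `LiuSlade2024_lem29` (Liu–Slade 2024, Lemma 2.9).** With `n = ⌊a⌋`,
`α = (j,…,j)` for the coordinate `j` maximising `|xⱼ|`, and `u = 1/(4|xⱼ|)`:
`(2π|xⱼ|)ⁿ|𝓕ĥ(x)| = |𝓕ĥ_α(x)|` (`mFourierCoeff_weakDeriv_replicate`),
`2|sin(2πxⱼu)| |𝓕ĥ_α(x)| = |𝓕(U_u ĥ_α)(x)| ≤ ‖U_u ĥ_α‖₁ ≤ K u^η` (`mFourierCoeff_torusDiff`) with
`sin(2πxⱼu) = ±1`, whence `|xⱼ|^{n+η}|𝓕ĥ(x)| ≤ K`; finally `|x| ≤ √d|xⱼ|`, `|x| ≥ 1` and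
`a = n + fract(a) < n + η` give `|h(x)| ≤ d^{(n+1)/2} ⟦x⟧^{-a}(‖ĥ‖₁ + K + M)` (the case `x = 0`
being `|𝓕ĥ(0)| ≤ ‖ĥ‖₁`). [cite: LiuSlade2024, Lemma 2.9 and its proof (§2.3.1), Lemma 2.8] -/
theorem LiuSlade2024_lem29_holds : LiuSlade2024_lem29 := by
  intro d hd a η ha hfr hfrη hη1
  generalize hn : ⌊a⌋₊ = n
  have hd' : (1 : ℝ) ≤ d := by exact_mod_cast hd
  have hsd : 1 ≤ Real.sqrt d := Real.one_le_sqrt.2 hd'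
  have hη0 : 0 < η := lt_of_le_of_lt (Int.fract_nonneg a) hfrη
  -- the exponent bookkeeping `a < n + η`
  have hexp : a < n + η := by
    have hfl : ((n : ℕ) : ℝ) = ((⌊a⌋ : ℤ) : ℝ) := by
      rw [← hn]; exact_mod_cast Int.natCast_floor_eq_floor ha.le
    have := Int.floor_add_fract a
    linarith
  refine ⟨Real.sqrt d ^ (n + 1), by positivity, ?_⟩
  intro hh v K M hint _hsymm hweak hM hK x
  obtain ⟨j₀⟩ : Nonempty (Fin d) := ⟨⟨0, hd⟩⟩
  have hK0 : 0 ≤ K := by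
    have h := hK (List.replicate n j₀) (List.length_replicate ..) j₀ 1 zero_le_one le_rfl
    rw [Real.one_rpow, mul_one] at h
    exact (integral_nonneg fun _ => norm_nonneg _).trans h
  have hM0 : 0 ≤ M :=
    (integral_nonneg fun _ => norm_nonneg _).trans (hM (List.replicate n j₀) (List.length_replicate ..))
  have hI0 : 0 ≤ ∫ t, ‖hh t‖ := integral_nonneg fun _ => norm_nonneg _
  have hc1 : 1 ≤ Real.sqrt d ^ (n + 1) := one_le_pow₀ hsd
  by_cases hx : x = 0
  · -- `x = 0`: `|𝓕ĥ(0)| ≤ ‖ĥ‖₁`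
    subst hx
    have h1 : jnorm (0 : Site d) = 1 := by simp [jnorm, euclidNorm]
    rw [h1, Real.one_rpow, div_one]
    calc ‖mFourierCoeff hh 0‖ ≤ ∫ t, ‖hh t‖ := norm_mFourierCoeff_le hh 0
      _ ≤ 1 * ((∫ t, ‖hh t‖) + K + M) := by linarith
      _ ≤ Real.sqrt d ^ (n + 1) * ((∫ t, ‖hh t‖) + K + M) := by gcongr
  · -- `x ≠ 0`: the coordinate `j` with `|xⱼ| = ‖x‖_∞ ≥ 1`
    obtain ⟨j, -, hj⟩ := Finset.exists_max_image Finset.univ (fun i => |x i|) ⟨j₀, Finset.mem_univ _⟩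
    have hxj : x j ≠ 0 := by
      intro h0
      apply hx
      funext i
      have := hj i (Finset.mem_univ i)
      rw [h0, abs_zero] at this
      exact abs_nonpos_iff.1 this
    set m : ℝ := |(x j : ℝ)| with hm
    have hm1 : 1 ≤ m := by
      rw [hm, ← Int.cast_abs]
      exact_mod_cast Int.one_le_abs hxj
    have hm0 : 0 < m := by linarith
    have hji : ∀ i, |(x i : ℝ)| ≤ m := fun i => by
      rw [hm, ← Int.cast_abs, ← Int.cast_abs]
      exact_mod_cast hj i (Finset.mem_univ i)
    -- Step 1: `mⁿ |𝓕ĥ(x)| ≤ |𝓕ĥ_α(x)|`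
    have hαlen : (List.replicate n j).length = n := List.length_replicate ..
    have hwα : HasTorusWeakDeriv hh (List.replicate n j) (v (List.replicate n j)) :=
      hweak _ hαlen.le
    have hcoef := mFourierCoeff_weakDeriv_replicate hwα x
    have hstep1 : m ^ n * ‖mFourierCoeff hh x‖ ≤ ‖mFourierCoeff (v (List.replicate n j)) x‖ := by
      rw [hcoef, norm_mul, norm_pow]
      have hnorm : ‖(2 * π * Complex.I * (x j : ℂ))‖ = 2 * π * m := by
        rw [norm_mul, norm_mul, norm_mul, Complex.norm_I, mul_one, Complex.norm_intCast,
          Complex.norm_real, Real.norm_eq_abs, abs_of_pos Real.pi_pos, Complex.norm_two]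
      rw [hnorm]
      gcongr
      · calc m = 1 * m := (one_mul m).symm
          _ ≤ 2 * π * m := by gcongr; linarith [Real.pi_gt_three]
    -- Step 2: `2 |𝓕ĥ_α(x)| ≤ K u^η` with `u = 1/(4m)`
    set u : ℝ := 1 / (4 * m) with hu
    have hu0 : 0 ≤ u := by positivity
    have hu1 : u ≤ 1 := by
      rw [hu, div_le_one (by positivity)]; linarith
    have hsin : ‖(fourier (x j) ((u : ℝ) : UnitAddCircle) : ℂ) -
        fourier (x j) (((-u : ℝ)) : UnitAddCircle)‖ = 2 := by
      rw [norm_fourier_sub_fourier_neg]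
      rcases lt_or_gt_of_ne hxj with hneg | hpos
      · have hneg' : (x j : ℝ) < 0 := by exact_mod_cast hneg
        have hmx : m = -(x j : ℝ) := abs_of_neg hneg'
        have : 2 * π * (x j : ℤ) * u = -(π / 2) := by
          rw [hu, hmx]; field_simp; ring
        rw [this, Real.sin_neg, Real.sin_pi_div_two]; norm_num
      · have hpos' : (0 : ℝ) < x j := by exact_mod_cast hpos
        have hmx : m = (x j : ℝ) := abs_of_pos hpos'
        have : 2 * π * (x j : ℤ) * u = π / 2 := by
          rw [hu, hmx]; field_simp; ring
        rw [this, Real.sin_pi_div_two]; norm_num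
    have hstep2 : 2 * ‖mFourierCoeff (v (List.replicate n j)) x‖ ≤ K * u ^ η := by
      have h := hK _ hαlen j u hu0 hu1
      calc 2 * ‖mFourierCoeff (v (List.replicate n j)) x‖
          = ‖mFourierCoeff (torusDiff j u (v (List.replicate n j))) x‖ := by
            rw [mFourierCoeff_torusDiff hwα.2.1 j u x, norm_mul, hsin]
        _ ≤ ∫ t, ‖torusDiff j u (v (List.replicate n j)) t‖ := norm_mFourierCoeff_le _ _
        _ ≤ K * u ^ η := h
    -- Step 3: `m^η |𝓕ĥ_α(x)| ≤ K`
    have hstep3 : m ^ η * ‖mFourierCoeff (v (List.replicate n j)) x‖ ≤ K := by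
      have h4m : (4 * m) ^ η * u ^ η = 1 := by
        rw [← Real.mul_rpow (by positivity) hu0, hu, mul_one_div_cancel (by positivity), Real.one_rpow]
      calc m ^ η * ‖mFourierCoeff (v (List.replicate n j)) x‖
          ≤ (4 * m) ^ η * ‖mFourierCoeff (v (List.replicate n j)) x‖ :=
            mul_le_mul_of_nonneg_right (Real.rpow_le_rpow hm0.le (by linarith) hη0.le)
              (norm_nonneg _)
        _ = (4 * m) ^ η * (2 * ‖mFourierCoeff (v (List.replicate n j)) x‖) / 2 := by ring
        _ ≤ (4 * m) ^ η * (K * u ^ η) / 2 := by gcongr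
        _ = K * ((4 * m) ^ η * u ^ η) / 2 := by ring
        _ ≤ K := by rw [h4m, mul_one]; linarith
    -- Step 4: `m^{n+η} |𝓕ĥ(x)| ≤ K`
    have hstep4 : m ^ ((n : ℝ) + η) * ‖mFourierCoeff hh x‖ ≤ K := by
      rw [Real.rpow_add hm0, Real.rpow_natCast]
      calc m ^ n * m ^ η * ‖mFourierCoeff hh x‖ = m ^ η * (m ^ n * ‖mFourierCoeff hh x‖) := by ring
        _ ≤ m ^ η * ‖mFourierCoeff (v (List.replicate n j)) x‖ := by
            gcongr
        _ ≤ K := hstep3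
    -- Step 5: `|x| ≤ √d m`, `⟦x⟧ = |x| ≥ 1`, `a < n + η`
    have hE : euclidNorm x ≤ Real.sqrt d * m := euclidNorm_le_sqrt_mul hm0.le hji
    have hE1 : 1 ≤ euclidNorm x := hm1.trans (abs_apply_le_euclidNorm x j)
    have hE0 : 0 < euclidNorm x := by linarith
    have hjn : jnorm x = euclidNorm x := max_eq_left hE1
    have hnη : (0 : ℝ) ≤ n + η := by positivity
    rw [hjn, div_mul_eq_mul_div, le_div_iff₀ (Real.rpow_pos_of_pos hE0 a)]
    calc ‖mFourierCoeff hh x‖ * euclidNorm x ^ a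
        ≤ ‖mFourierCoeff hh x‖ * euclidNorm x ^ ((n : ℝ) + η) :=
          mul_le_mul_of_nonneg_left (Real.rpow_le_rpow_of_exponent_le hE1 hexp.le) (norm_nonneg _)
      _ ≤ ‖mFourierCoeff hh x‖ * (Real.sqrt d * m) ^ ((n : ℝ) + η) :=
          mul_le_mul_of_nonneg_left (Real.rpow_le_rpow hE0.le hE hnη) (norm_nonneg _)
      _ = Real.sqrt d ^ ((n : ℝ) + η) * (m ^ ((n : ℝ) + η) * ‖mFourierCoeff hh x‖) := by
          rw [Real.mul_rpow (Real.sqrt_nonneg _) hm0.le]; ring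
      _ ≤ Real.sqrt d ^ ((n : ℝ) + η) * K := by gcongr
      _ ≤ Real.sqrt d ^ (n + 1) * K := by
          gcongr
          calc Real.sqrt d ^ ((n : ℝ) + η) ≤ Real.sqrt d ^ ((n : ℝ) + 1) :=
                Real.rpow_le_rpow_of_exponent_le hsd (by linarith)
            _ = Real.sqrt d ^ (n + 1) := by
                rw [← Real.rpow_natCast]; push_cast; ring_nf
      _ ≤ Real.sqrt d ^ (n + 1) * ((∫ t, ‖hh t‖) + K + M) := by
          gcongr; linarith

/-! ## Part 3. Liu–Slade 2024, Lemma 2.3 (= Liu–Slade 2026, Lemma 3.1): integer order -/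

/-- **Liu–Slade 2024, Lemma 2.3 = Liu–Slade 2026, Lemma 3.1** (decay of Fourier coefficients from
integrable weak derivatives): "Let `n, d > 0` be positive integers. Suppose that `ĥ : 𝕋^d → ℂ` is
`n` times weakly differentiable, and let `h : ℤ^d → ℂ` be the inverse Fourier transform of `ĥ`.
There is a constant `c_{d,n}` depending only on the dimension `d` and the order `n` of
differentiation, such that `|h(x)| ≤ c_{d,n} ⟦x⟧^{-n} max_{|α| ∈ {0,n}} ‖ĥ_α‖_1`. Moreover,
`|x|ⁿ h(x) → 0` as `|x| → ∞`." Here `h(x) = 𝓕ĥ(x) = mFourierCoeff ĥ x`, "`n` times weakly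
differentiable" is a family `v β` of weak derivatives for `|β| ≤ n` (`HasTorusWeakDeriv`,
Definition A.1, multi-indices as words of directions), the maximum over `|α| = n` is replaced by a
common upper bound `M` of the `‖ĥ_α‖₁` (equivalent), and `|x|ⁿ h(x) → 0` is convergence along the
cofinite filter of `ℤ^d`; `c_{d,n} = d^{n/2}`. Proof as printed: `(2πi x_j)ⁿ 𝓕ĥ(x) = 𝓕ĥ_α(x)` for
`α = (j,…,j)` with `|x_j| = ‖x‖_∞ ≥ |x|/√d` (integration by parts,
`mFourierCoeff_weakDeriv_replicate`), `|𝓕ĥ_α(x)| ≤ ‖ĥ_α‖₁`, and the Riemann–Lebesgue lemma for the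
`d` functions `ĥ_{(j,…,j)}`. [cite: LiuSlade2024, Lemma 2.3 and its proof (§2.2.1)]
[cite: LiuSlade2026, Lemma 3.1 with (3.7)] [cite: Grafakos2014, Prop. 3.3.1] -/
theorem LiuSlade2024_lem23 (hd : 0 < d) {n : ℕ} (hn : 0 < n) :
    ∃ c : ℝ, 0 < c ∧
      ∀ (hh : UnitAddTorus (Fin d) → ℂ) (v : List (Fin d) → UnitAddTorus (Fin d) → ℂ) (M : ℝ),
        (∀ β : List (Fin d), β.length ≤ n → HasTorusWeakDeriv hh β (v β)) →
        (∀ α : List (Fin d), α.length = n → (∫ t, ‖v α t‖) ≤ M) →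
        (∀ x : Site d, ‖mFourierCoeff hh x‖ ≤ c / jnorm x ^ n * max (∫ t, ‖hh t‖) M) ∧
        Tendsto (fun x : Site d => euclidNorm x ^ n * ‖mFourierCoeff hh x‖) cofinite (𝓝 0) := by
  refine ⟨Real.sqrt d ^ n, by positivity, fun hh v M hweak hM => ?_⟩
  have hd' : (1 : ℝ) ≤ d := by exact_mod_cast hd
  have hsd : 1 ≤ Real.sqrt d := Real.one_le_sqrt.2 hd'
  have hc1 : 1 ≤ Real.sqrt d ^ n := one_le_pow₀ hsd
  obtain ⟨j₀⟩ : Nonempty (Fin d) := ⟨⟨0, hd⟩⟩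
  have hint : Integrable hh := (hweak [] (by simp)).1
  have hM0 : 0 ≤ M :=
    (integral_nonneg fun _ => norm_nonneg _).trans (hM (List.replicate n j₀) (List.length_replicate ..))
  have hI0 : 0 ≤ ∫ t, ‖hh t‖ := integral_nonneg fun _ => norm_nonneg _
  -- the key estimate off the origin: `|x|ⁿ |𝓕ĥ(x)| ≤ d^{n/2} |𝓕ĥ_{(j,…,j)}(x)|` for the maximising `j`
  have key : ∀ x : Site d, x ≠ 0 → ∃ j : Fin d, 1 ≤ euclidNorm x ∧
      euclidNorm x ^ n * ‖mFourierCoeff hh x‖ ≤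
        Real.sqrt d ^ n * ‖mFourierCoeff (v (List.replicate n j)) x‖ := by
    intro x hx
    obtain ⟨j, -, hj⟩ := Finset.exists_max_image Finset.univ (fun i => |x i|) ⟨j₀, Finset.mem_univ _⟩
    have hxj : x j ≠ 0 := by
      intro h0
      apply hx
      funext i
      have := hj i (Finset.mem_univ i)
      rw [h0, abs_zero] at this
      exact abs_nonpos_iff.1 this
    set m : ℝ := |(x j : ℝ)| with hm
    have hm1 : 1 ≤ m := by
      rw [hm, ← Int.cast_abs]
      exact_mod_cast Int.one_le_abs hxj
    have hm0 : 0 < m := by linarith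
    have hji : ∀ i, |(x i : ℝ)| ≤ m := fun i => by
      rw [hm, ← Int.cast_abs, ← Int.cast_abs]
      exact_mod_cast hj i (Finset.mem_univ i)
    have hcoef := mFourierCoeff_weakDeriv_replicate
      (hweak (List.replicate n j) (List.length_replicate ..).le) x
    have hstep1 : m ^ n * ‖mFourierCoeff hh x‖ ≤ ‖mFourierCoeff (v (List.replicate n j)) x‖ := by
      rw [hcoef, norm_mul, norm_pow]
      have hnorm : ‖(2 * π * Complex.I * (x j : ℂ))‖ = 2 * π * m := by
        rw [norm_mul, norm_mul, norm_mul, Complex.norm_I, mul_one, Complex.norm_intCast,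
          Complex.norm_real, Real.norm_eq_abs, abs_of_pos Real.pi_pos, Complex.norm_two]
      rw [hnorm]
      gcongr
      · calc m = 1 * m := (one_mul m).symm
          _ ≤ 2 * π * m := by gcongr; linarith [Real.pi_gt_three]
    have hE : euclidNorm x ≤ Real.sqrt d * m := euclidNorm_le_sqrt_mul hm0.le hji
    have hE1 : 1 ≤ euclidNorm x := hm1.trans (abs_apply_le_euclidNorm x j)
    refine ⟨j, hE1, ?_⟩
    calc euclidNorm x ^ n * ‖mFourierCoeff hh x‖ ≤ (Real.sqrt d * m) ^ n * ‖mFourierCoeff hh x‖ :=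
          mul_le_mul_of_nonneg_right (pow_le_pow_left₀ (by linarith) hE n) (norm_nonneg _)
      _ = Real.sqrt d ^ n * (m ^ n * ‖mFourierCoeff hh x‖) := by rw [mul_pow]; ring
      _ ≤ Real.sqrt d ^ n * ‖mFourierCoeff (v (List.replicate n j)) x‖ :=
          mul_le_mul_of_nonneg_left hstep1 (by positivity)
  constructor
  · -- the bound (3.7)
    intro x
    by_cases hx : x = 0
    · subst hx
      have h1 : jnorm (0 : Site d) = 1 := by simp [jnorm, euclidNorm]
      rw [h1, one_pow, div_one]
      calc ‖mFourierCoeff hh 0‖ ≤ ∫ t, ‖hh t‖ := norm_mFourierCoeff_le hh 0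
        _ ≤ 1 * max (∫ t, ‖hh t‖) M := by rw [one_mul]; exact le_max_left _ _
        _ ≤ Real.sqrt d ^ n * max (∫ t, ‖hh t‖) M :=
            mul_le_mul_of_nonneg_right hc1 (le_max_of_le_left hI0)
    · obtain ⟨j, hE1, hkey⟩ := key x hx
      have hjn : jnorm x = euclidNorm x := max_eq_left hE1
      have hE0 : 0 < euclidNorm x := by linarith
      rw [hjn, div_mul_eq_mul_div, le_div_iff₀ (pow_pos hE0 n), mul_comm]
      calc euclidNorm x ^ n * ‖mFourierCoeff hh x‖
          ≤ Real.sqrt d ^ n * ‖mFourierCoeff (v (List.replicate n j)) x‖ := hkey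
        _ ≤ Real.sqrt d ^ n * M :=
            mul_le_mul_of_nonneg_left
              ((norm_mFourierCoeff_le _ _).trans (hM _ (List.length_replicate ..))) (by positivity)
        _ ≤ Real.sqrt d ^ n * max (∫ t, ‖hh t‖) M :=
            mul_le_mul_of_nonneg_left (le_max_right _ _) (by positivity)
  · -- `|x|ⁿ h(x) → 0`: Riemann–Lebesgue for the `d` top-order weak derivatives `ĥ_{(j,…,j)}`
    have hRL : ∀ j : Fin d,
        Tendsto (fun x : Site d => ‖mFourierCoeff (v (List.replicate n j)) x‖) cofinite (𝓝 0) := by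
      intro j
      have h := (Literature.Analysis.Fourier.tendsto_mFourierCoeff_cofinite
        (hweak (List.replicate n j) (List.length_replicate ..).le).2.1).norm
      rwa [norm_zero] at h
    have hsum : Tendsto (fun x : Site d =>
        Real.sqrt d ^ n * ∑ j, ‖mFourierCoeff (v (List.replicate n j)) x‖) cofinite (𝓝 0) := by
      have h := (tendsto_finsetSum Finset.univ fun j _ => hRL j).const_mul (Real.sqrt d ^ n)
      rwa [Finset.sum_const_zero, mul_zero] at h
    refine squeeze_zero_norm' (Eventually.of_forall fun x => ?_) hsum
    rw [Real.norm_eq_abs, abs_of_nonneg (mul_nonneg (pow_nonneg (euclidNorm_nonneg x) n) (norm_nonneg _))]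
    by_cases hx : x = 0
    · subst hx
      have h0 : euclidNorm (0 : Site d) = 0 := by simp [euclidNorm]
      rw [h0, zero_pow hn.ne', zero_mul]
      positivity
    · obtain ⟨j, -, hkey⟩ := key x hx
      refine hkey.trans (mul_le_mul_of_nonneg_left ?_ (by positivity))
      exact Finset.single_le_sum (fun i _ => norm_nonneg (mFourierCoeff (v (List.replicate n i)) x))
        (Finset.mem_univ j)

end Literature.Barriers.CriticalPhenomena.SpreadOutIsing

end
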